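import Literature.AlgebraicGeometry.HodgeTheory.RationalHodgeClasses
import Literature.AlgebraicGeometry.HodgeTheory.AlgebraicClasses
import Literature.Geometry.Kaehler.AnalyticSet
import Literature.Geometry.Kaehler.Kaehler
import Mathlib.Geometry.Manifold.VectorBundle.Riemannian
import Mathlib.LinearAlgebra.Complex.FiniteDimensional
import HarnessLib

/-!
# Route `HolomorphicityRate`, crux `SuperThresholdRigidity` (stmt-HodgeConjecture-2737) — stub 1, edge codimensions

The Newton–Kuranishi stub of the crux skeleton `Cruxes/SuperThresholdRigidity/Lines/birth.lean` (line
`registered`) in the two codimensions where it is automatic: for `p = 0` the local submersions take values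
in `ℝ⁰`, and for `p = n` a submersion `T_x X^an ≅ ℝ^{2n} → ℝ^{2n}` is injective, so the kernel clause
"`df_x v = 0 → df_x (J v) = 0`" of a holomorphic support already holds for the given nearly-holomorphic
support `(S, Sg)`, which is returned unchanged (connectedness dropped). Helper
(`--supports stmt-HodgeConjecture-2737`, registered stub `stub_newtonBelowThreshold_edge`); the open content
of the crux is the middle range `0 < p < n` (`stub_newtonBelowThreshold_mid`).
-/

-- the problem path `HodgeConjecture/HodgeConjecture` (single-problem summit) repeats a namespace segment
set_option linter.dupNamespace false

open scoped Manifold Topology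

namespace Summit.HodgeConjecture.HodgeConjecture.Theorems

/-- **Newton stub, edge codimensions `p = 0` and `p = n` (automatic).** For a Hodge model `A` of an
`n`-dimensional smooth projective `X` (so `dim_ℂ A.model = n`) and `p = 0` or `p = n`, every support `(S, Sg)`
satisfying the route's nearly-holomorphic clause with ANY defect already satisfies the holomorphic-support
clause: at `x ∈ S ∖ Sg` keep the given `U`, `f`; if `p = 0` the target `Fin 0 → ℝ` is a subsingleton, and if
`p = n` the onto differential `df_x : T_x ≅ ℝ^{2n} → ℝ^{2n}` is one-to-one
(`LinearMap.injective_iff_surjective_of_finrank_eq_finrank`, `finrank_real_of_complex`,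
`IsAnalytification.finrank_eq`), so `df_x v = 0` forces `v = 0`. All other clauses, and the vanishing of the
ray class off `S`, are copied. [folklore] -/
theorem stub_newtonBelowThreshold_edge : ∀ (n p : ℕ) (X : Literature.AlgebraicGeometry.Motives.SchemeOver ℂ), Literature.AlgebraicGeometry.Motives.IsSmoothProjective n X → p ≤ n → (p = 0 ∨ p = n) → ∀ (A : Literature.AlgebraicGeometry.HodgeTheory.HodgeModel n X) (g : Bundle.ContMDiffRiemannianMetric 𝓘(ℝ, A.model) ((⊤ : ℕ∞) : WithTop ℕ∞) A.model (fun x : A.carrier => TangentSpace 𝓘(ℝ, A.model) x)) (c hp : Literature.AlgebraicGeometry.HodgeTheory.complexBetti X (2 * p)) (m : ℕ) (C : ℝ) (a : ℕ → ℕ) (t : ℕ → ℝ), Literature.AlgebraicGeometry.HodgeTheory.IsRationalClass hp → hp ∈ Literature.AlgebraicGeometry.HodgeTheory.algebraicClasses X p → 0 < m → (∀ k, (a k : ℝ) ≤ C * (k : ℝ) ^ p) → Filter.Tendsto (fun k : ℕ => t k * (k : ℝ) ^ p) Filter.atTop (nhds 0) → A.pullback (2 * p) c ∈ A.hodgePQ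 (2 * p) p p → ∀ᶠ k : ℕ in Filter.atTop, (∃ S Sg : Set A.carrier, (IsClosed S ∧ IsClosed Sg ∧ Sg ⊆ S ∧ IsConnected (S \ Sg) ∧ (∀ x ∈ Sg, Literature.Geometry.Kaehler.IsAnalyticSetAt 𝓘(ℂ, A.model) S x) ∧ (∃ T : Set A.carrier, Sg ⊆ T ∧ (Literature.Geometry.Kaehler.IsAnalyticSet 𝓘(ℂ, A.model) T ∧ ∀ x ∈ Literature.Geometry.Kaehler.regularLocus 𝓘(ℂ, A.model) T, ∀ q : ℕ, Literature.Geometry.Kaehler.IsRegularPointOfCodim 𝓘(ℂ, A.model) T q x → p + 1 ≤ q)) ∧ (∀ x ∈ S \ Sg, ∃ U : Set A.carrier, IsOpen U ∧ x ∈ U ∧ ∃ f : A.carrier → (Fin (2 * p) → ℝ), ContMDiffOn 𝓘(ℝ, A.model) 𝓘(ℝ, Fin (2 * p) → ℝ) 1 f U ∧ S ∩ U = U ∩ f ⁻¹' {0} ∧ Function.Surjective (mfderiv 𝓘(ℝ, A.model) 𝓘(ℝ, Fin (2 * p) → ℝ) f x) ∧ ∀ v : TangentSpace 𝓘(ℝ,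 A.model) x, mfderiv 𝓘(ℝ, A.model) 𝓘(ℝ, Fin (2 * p) → ℝ) f x v = 0 → ∃ w : TangentSpace 𝓘(ℝ, A.model) x, mfderiv 𝓘(ℝ, A.model) 𝓘(ℝ, Fin (2 * p) → ℝ) f x w = 0 ∧ g.inner x (Literature.Geometry.Kaehler.tangentJ A.model x v - w) (Literature.Geometry.Kaehler.tangentJ A.model x v - w) ≤ (t k) ^ 2 * g.inner x v v)) ∧ Literature.AlgebraicTopology.SingularHomology.singularCohomology.map ℂ ℂ (⟨Subtype.val, continuous_subtype_val⟩ : C({x : A.carrier // x ∉ S}, A.carrier)) (2 * p) (A.pullback (2 * p) (((m : ℂ) • c + ((a k : ℕ) : ℂ) • hp))) = 0) → ∃ S Sg : Set A.carrier, (IsClosed S ∧ IsClosed Sg ∧ Sg ⊆ S ∧ (∀ x ∈ Sg, Literature.Geometry.Kaehler.IsAnalyticSetAt 𝓘(ℂ, A.model) S x) ∧ (∃ T : Set A.carrier, Sg ⊆ T ∧ (Literature.Geometry.Kaehler.IsAnalyticSet 𝓘(ℂ, A.model) T ∧ ∀ x ∈ Literature.Geometry.Kaehler.regularLocus 𝓘(ℂ,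 A.model) T, ∀ q : ℕ, Literature.Geometry.Kaehler.IsRegularPointOfCodim 𝓘(ℂ, A.model) T q x → p + 1 ≤ q)) ∧ (∀ x ∈ S \ Sg, ∃ U : Set A.carrier, IsOpen U ∧ x ∈ U ∧ ∃ f : A.carrier → (Fin (2 * p) → ℝ), ContMDiffOn 𝓘(ℝ, A.model) 𝓘(ℝ, Fin (2 * p) → ℝ) 1 f U ∧ S ∩ U = U ∩ f ⁻¹' {0} ∧ Function.Surjective (mfderiv 𝓘(ℝ, A.model) 𝓘(ℝ, Fin (2 * p) → ℝ) f x) ∧ ∀ v : TangentSpace 𝓘(ℝ, A.model) x, mfderiv 𝓘(ℝ, A.model) 𝓘(ℝ, Fin (2 * p) → ℝ) f x v = 0 → mfderiv 𝓘(ℝ, A.model) 𝓘(ℝ, Fin (2 * p) → ℝ) f x (Literature.Geometry.Kaehler.tangentJ A.model x v) = 0)) ∧ Literature.AlgebraicTopology.SingularHomology.singularCohomology.map ℂ ℂ (⟨Subtype.val, continuous_subtype_val⟩ : C({x : A.carrier // x ∉ S}, A.carrier)) (2 * p) (A.pullback (2 * p) (((m : ℂ) • c + ((a k : ℕ) : ℂ)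 • hp))) = 0 := by
  intro n p X _hX _hpn hedge A g c hp m C a t _hrat _halg _hm _hbud _ht _hH
  refine Filter.Eventually.of_forall fun k => ?_
  rintro ⟨S, Sg, ⟨hS, hSg, hsub, -, han, hT, hreg⟩, hsupp⟩
  refine ⟨S, Sg, ⟨hS, hSg, hsub, han, hT, fun x hx => ?_⟩, hsupp⟩
  obtain ⟨U, hU, hxU, f, hf, hSU, hsurj, -⟩ := hreg x hx
  refine ⟨U, hU, hxU, f, hf, hSU, hsurj, fun v hv => ?_⟩
  rcases hedge with h0 | hn
  · -- `p = 0`: the target `Fin 0 → ℝ` is trivial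
    subst h0
    exact funext fun i => absurd i.2 (by omega)
  · -- `p = n`: an onto linear map `ℝ^{2n} ≅ T_x → ℝ^{2n}` is one-to-one, so `v = 0`
    set L := mfderiv 𝓘(ℝ, A.model) 𝓘(ℝ, Fin (2 * p) → ℝ) f x with hL
    have hdim : Module.finrank ℝ (TangentSpace 𝓘(ℝ, A.model) x) =
        Module.finrank ℝ (Fin (2 * p) → ℝ) := by
      change Module.finrank ℝ A.model = _
      rw [finrank_real_of_complex, A.isAnalytification.finrank_eq, Module.finrank_fin_fun, hn]
    have hinj : Function.Injective L.toLinearMap :=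
      (LinearMap.injective_iff_surjective_of_finrank_eq_finrank hdim).2 hsurj
    have hv0 : v = 0 := hinj (by rw [ContinuousLinearMap.coe_coe, hv, map_zero])
    rw [hv0, map_zero, map_zero]

end Summit.HodgeConjecture.HodgeConjecture.Theorems
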